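import Summits.BirchSwinnertonDyer.BirchSwinnertonDyer.Theorems.GoldfeldAllTwistsTwoConverseTwinHalfTraceSevenModEightPartner
import Summits.BirchSwinnertonDyer.BirchSwinnertonDyer.Theorems.GoldfeldAllTwistsTwoConverseTwinQuarterTracePartnerEHeight
import Summits.BirchSwinnertonDyer.BirchSwinnertonDyer.Theorems.GoldfeldAllTwistsTwoConverseTwinQuarterTraceTorsion
import Literature.NumberTheory.QuadraticFields.DiscriminantOfSqrt
import Literature.NumberTheory.EllipticCurves.HeegnerPointsShimuraReciprocityHoldsProofs
import HarnessLib

set_option linter.dupNamespace false -- namespace `…BirchSwinnertonDyer.BirchSwinnertonDyer…` is the cell's (D-0017 nested layout)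
set_option autoImplicit false

/-!
# LINE C3⁺ (PHASE 2), file P2e-2: the `χ_e` partner point `Y_e = y_{ℚ(√−qp)} ∈ X₀(49)(K[1])`, `K = ℚ(√−2qp)` —
# Birch's relation with EVEN class number `h(−qp)`: `Y_e + tY_e = O` for every `t` with `t√−qp = −√−qp`

Cell `bsd-goldfeld`, seat `bsd-goldfeld-s1p-c3x` (gen 7); planner ORDER (ccxxix)/(ccxxxi) «LINE C3⁺», tranche 2, file P2e (the `χ_e`
partner, `χ_e = χ_qχ_p`), point half (the height half is P2e-1 `…TwinQuarterTracePartnerEHeight`). `--supports stmt-BirchSwinnertonDyer-20044`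
as a HELPER. Theses-free; theorems only; no definition, no `sorry`, NO new fact: the two named inputs are A″'s — `w(49a1) = +1` (`hw`) and
the cusp value `φ₀(0) = T` (`h0`); everything else is proved in the tree and cited (A″ `map_cm7_heegnerPoint_conj_add_eq_card_smul`, ty's
Shimura-reciprocity bijection `heegnerFormClass_bijective`, P2f's genus count `index_range_sq_classGroup_QO_eq_two_negTwoPrimes`).

CONTENT. §1 `s = √−qp ∈ K[1]` (in the assembly `s = r_q·r_p`): `K₂ = ℚ⟮s⟯ ⊂ K[1]` is imaginary quadratic of discriminant `−qp`
(`−qp ≡ 1 (mod 4)` square-free: Marcus Ch. 2 Thm 1, tree `discr_eq_of_sq_eq_intCast_of_neg`), satisfies the Heegner hypothesis for `49`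
(`(−qp/7) = (−1/7)(q/7)(p/7) = +1`), and has EVEN class number (`[C : C²] = 2`, two assigned characters). §2 THE PARTNER POINT (A″'s
`exists_partnerPoint_negEightPrime` with odd ↦ even): a Heegner datum `H₂`, a point `P₂ ∈ X₀(49)(K₂)` over the Heegner point of `(D₀, H₂)`,
`Y_e := P₂ ∈ X₀(49)(K[1])` FIXED by every `ℚ`-algebra map fixing `s` and with **`Y_e + tY_e = O`** for every one negating `s`. So `Y_e` is a
`χ_e`-point of `X₀(49)(K[1])` negated by complex conjugation — (H3ₑ)–(H4ₑ) of the quarter-trace assembly. HONEST FRAMING: Heegner-point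
bookkeeping; no `L`-value; no case of K12₂″ / twin″ decided; BSD is not proved by any of this.

References: [Gross1984] §5 (5.2)–(5.3); [GrossLMS1991] Prop. 5.3; [Darmon2004] Thm. 3.6, Prop. 3.11; [Cox2013] §3.B Thm. 3.15, §7.B Thm. 7.7;
[Marcus2018] Ch. 2 Thm. 1. -/

noncomputable section

open scoped Classical IntermediateField

open WeierstrassCurve Literature.NumberTheory.EllipticCurves Literature.NumberTheory.EllipticCurves.ModularForms
  Literature.Computability.Cryptography.Hallgren2005

namespace Summit.BirchSwinnertonDyer.BirchSwinnertonDyer.Theorems.GoldfeldGoodTwists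

/-! ## §1 The field `ℚ(√−qp) ⊂ K[1]` -/

section Field

/-- `−qp` is not a square in `ℚ`. [folklore] -/
theorem not_isSquare_neg_two_primes_rat {q p : ℕ} (hq : q.Prime) (hp : p.Prime) : ¬ IsSquare (-((q : ℚ) * p)) := by
  rintro ⟨b, hb⟩
  have : (0 : ℚ) < q := by exact_mod_cast hq.pos
  have : (0 : ℚ) < p := by exact_mod_cast hp.pos
  nlinarith [mul_self_nonneg b]

variable {K : Type} [Field K] [NumberField K] (ι : K →+* ℂ)

/-- `s² = −qp` read in `K[1]` over `ℚ`. [folklore] -/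
theorem sq_eq_algebraMap_neg_two_primes_of_coe_sq {q p : ℕ} {s : ringClassField K ι 1} (hs : (s : ℂ) ^ 2 = -((q : ℂ) * p)) :
    s ^ 2 = algebraMap ℚ (ringClassField K ι 1) (-((q : ℚ) * p)) := by
  apply Subtype.ext
  rw [map_neg, map_mul, map_natCast, map_natCast]
  push_cast
  exact hs

/-- `[ℚ⟮s⟯ : ℚ] = 2` for `s² = −qp`. [folklore] -/
theorem finrank_adjoin_sqrt_neg_two_primes [NumberField (ringClassField K ι 1)] {q p : ℕ} (hq : q.Prime) (hp : p.Prime)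
    {s : ringClassField K ι 1} (hs : (s : ℂ) ^ 2 = -((q : ℂ) * p)) : Module.finrank ℚ ℚ⟮s⟯ = 2 :=
  finrank_adjoin_sqrt_eq_two (k := ℚ) (sq_eq_algebraMap_neg_two_primes_of_coe_sq ι hs) (not_isSquare_neg_two_primes_rat hq hp)

/-- The generator `s ∈ ℚ⟮s⟯` squares to `−qp`. [folklore] -/
theorem adjoinGen_sq_neg_two_primes {q p : ℕ} {s : ringClassField K ι 1} (hs : (s : ℂ) ^ 2 = -((q : ℂ) * p)) :
    (⟨s, IntermediateField.mem_adjoin_simple_self ℚ s⟩ : ℚ⟮s⟯) ^ 2 =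
      algebraMap ℚ (ℚ⟮s⟯ : IntermediateField ℚ (ringClassField K ι 1)) (-((q : ℚ) * p)) := by
  apply Subtype.ext
  apply Subtype.ext
  rw [map_neg, map_mul, map_natCast, map_natCast]
  push_cast
  exact hs

/-- `ℚ⟮s⟯` is imaginary quadratic. [cite: Cox2013, §5.B (p. 119)] -/
theorem isImaginaryQuadratic_adjoin_sqrt_neg_two_primes [NumberField (ringClassField K ι 1)] {q p : ℕ} (hq : q.Prime)
    (hp : p.Prime) {s : ringClassField K ι 1} (hs : (s : ℂ) ^ 2 = -((q : ℂ) * p)) :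
    IsImaginaryQuadratic (ℚ⟮s⟯ : IntermediateField ℚ (ringClassField K ι 1)) :=
  IsImaginaryQuadratic.of_sq_eq (finrank_adjoin_sqrt_neg_two_primes ι hq hp hs) (adjoinGen_sq_neg_two_primes ι hs)
    (by have : (0 : ℚ) < q := by exact_mod_cast hq.pos
        have : (0 : ℚ) < p := by exact_mod_cast hp.pos
        nlinarith)

/-- `d(ℚ⟮s⟯) = −qp` (`−qp ≡ 1 (mod 4)` square-free, `q ≡ 3`, `p ≡ 1 (mod 4)`: Marcus Ch. 2 Thm. 1). [cite: Marcus2018, Ch. 2 Thm. 1]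
[cite: Cox2013, (2.21)] -/
theorem discr_adjoin_sqrt_neg_two_primes [NumberField (ringClassField K ι 1)] {q p : ℕ} (hq : q.Prime) (hp : p.Prime)
    (hq4 : q % 4 = 3) (hp4 : p % 4 = 1) (hqp : q ≠ p) {s : ringClassField K ι 1} (hs : (s : ℂ) ^ 2 = -((q : ℂ) * p)) :
    NumberField.discr (ℚ⟮s⟯ : IntermediateField ℚ (ringClassField K ι 1)) = -((q : ℤ) * p) := by
  obtain ⟨h4, hsq, -⟩ := isFundamental_neg_two_primes hq hp hq4 hp4 hqp
  exact Literature.NumberTheory.QuadraticFields.Quadratic.discr_eq_of_sq_eq_intCast_of_neg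
    (finrank_adjoin_sqrt_neg_two_primes ι hq hp hs) (θ := ⟨s, IntermediateField.mem_adjoin_simple_self ℚ s⟩)
    (by rw [adjoinGen_sq_neg_two_primes ι hs, map_neg, map_mul, map_natCast, map_natCast]; push_cast; ring)
    (by have := hq.pos; have := hp.pos; nlinarith) h4 hsq

/-- `7` splits in `ℚ(√−qp)` when `(q/7) = −1`, `(p/7) = +1`: the Heegner hypothesis for `49`. [cite: Gross1984, §3 (Heegner hypothesis)] -/
theorem satisfiesHeegnerHypothesis_adjoin_sqrt_neg_two_primes [NumberField (ringClassField K ι 1)] {q p : ℕ} (hq : q.Prime)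
    (hp : p.Prime) (hq4 : q % 4 = 3) (hp4 : p % 4 = 1) (hqp : q ≠ p) (hq7 : jacobiSym q 7 = -1) (hp7 : jacobiSym p 7 = 1)
    {s : ringClassField K ι 1} (hs : (s : ℂ) ^ 2 = -((q : ℂ) * p)) {N : ℕ} (hN : cm7.conductorNorm ℤ = N) :
    SatisfiesHeegnerHypothesis N (ℚ⟮s⟯ : IntermediateField ℚ (ringClassField K ι 1)) := by
  subst hN
  rw [conductorNorm_cm7, satisfiesHeegnerHypothesis_iff_kronecker 49 _ (finrank_adjoin_sqrt_neg_two_primes ι hq hp hs)]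
  intro p' hp' hp49
  have hp7e : p' = 7 := by
    have h : p' ∣ 7 ^ 2 := by simpa using hp49
    exact (Nat.prime_dvd_prime_iff_eq hp' (by norm_num)).mp (hp'.dvd_of_dvd_pow h)
  subst hp7e
  refine ⟨fun h ↦ by omega, fun _ ↦ ?_⟩
  rw [discr_adjoin_sqrt_neg_two_primes ι hq hp hq4 hp4 hqp hs, show (-((q : ℤ) * p)) = -1 * ((q : ℤ) * p) by ring,
    jacobiSym.mul_left, jacobiSym.mul_left, jacobiSym.at_neg_one (by norm_num), ZMod.χ₄_nat_three_mod_four (by norm_num)]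
  have hq7z : jacobiSym (q : ℤ) 7 = -1 := hq7
  have hpjz : jacobiSym (p : ℤ) 7 = 1 := hp7
  rw [hq7z, hpjz]
  norm_num

end Field

/-! ## §2 Even class number `h(−8q)` and the partner point -/

section Partner

/-- **`h(−qp)` is even**, read on Gross's representatives: `#H.reps = #C(𝒪_{−qp})` (Shimura reciprocity bijection `Q ↦ [𝔞_Q]`) and
`[C : C²] = 2` (two assigned characters, P2f). [cite: Cox2013, §3.B Thm. 3.15 and §7.B Thm. 7.7 (ii)] [cite: Gross1984, §I.1] -/
theorem even_card_reps_of_discr_negTwoPrimes {F : Type} [Field F] [NumberField F] (hF : IsImaginaryQuadratic F) {q p : ℕ}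
    (hq : q.Prime) (hp : p.Prime) (hq4 : q % 4 = 3) (hp4 : p % 4 = 1) (hqp : q ≠ p) (hdF : NumberField.discr F = -((q : ℤ) * p))
    {N : ℕ} [NeZero N] {W : WeierstrassCurve ℚ} [W.IsElliptic] (hH : SatisfiesHeegnerHypothesis N F)
    (Dt : ModularParametrizationData W N) (H : HeegnerDatum N (NumberField.discr F)) (ιF : F →+* ℂ) : Even H.reps.card := by
  have hbij := heegnerPoints_shimuraReciprocity.heegnerFormClass_bijective
    (heegnerPoints_shimuraReciprocity_holds N W F) hF hH Dt H ιF
  haveI : Finite (ClassGroup (OrderCl.QO hF.negDiscr)) := Finite.of_surjective _ hbij.2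
  have hcard : H.reps.card = Nat.card (ClassGroup (OrderCl.QO hF.negDiscr)) := by
    rw [← Fintype.card_coe, ← Nat.card_eq_fintype_card]
    exact Nat.card_eq_of_bijective _ hbij
  have hΔ : hF.negDiscr.D = -((q : ℤ) * p) := by rw [hF.negDiscr_D, hdF]
  have hΔ4 : hF.negDiscr.D % 4 = 1 := by rw [hΔ]; exact (isFundamental_neg_two_primes hq hp hq4 hp4 hqp).1
  have hidx := index_range_sq_classGroup_QO_eq_two_negTwoPrimes hF.negDiscr hq hp (by omega) (by omega) hqp hΔ hΔ4
  rw [hcard, ← Subgroup.card_mul_index (powMonoidHom 2 : _ →* ClassGroup (OrderCl.QO hF.negDiscr)).range, hidx]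
  exact even_two.mul_left _

variable {K : Type} [Field K] [NumberField K] (ι : K →+* ℂ)

-- One decidability world for the point groups over `K[1]` and `ℚ⟮s⟯` (as in A″'s `…SevenModEightPartner`); file-local.
attribute [local instance 2000] Classical.propDecidable

/-- **The `χ_e` partner point (hypotheses (H3ₑ)–(H4ₑ) of the quarter-trace assembly, discharged).** For `s ∈ K[1]`, `s² = −qp`
(`q ≡ 3`, `p ≡ 1 (mod 4)` primes, `(q/7) = −1`, `(p/7) = +1`): with `K₂ = ℚ⟮s⟯ ⊂ K[1]` there are a Heegner datum `H₂` and a Heegner point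
`P₂ ∈ X₀(49)(K₂)` over `Σ_Q φ(τ_Q)` such that `Y_e := P₂ ∈ X₀(49)(K[1])` is fixed by every `ℚ`-algebra map of `K[1]` fixing `s` and satisfies
**`Y_e + tY_e = O`** for every one with `t s = −s` (Birch's relation with `h(−qp)` EVEN). Inputs BY NAME: `w(49a1) = +1` (`hw`), (T-φ0) (`h0`).
[cite: Gross1984, §5 (5.2)–(5.3)] [cite: GrossLMS1991, Prop. 5.3] [cite: Darmon2004, Thm. 3.6 and Prop. 3.11] [cite: Cox2013, §3.B Thm. 3.15] -/
theorem exists_partnerPoint_negTwoPrimes [NumberField (ringClassField K ι 1)] (hw : cm7.rootNumber = 1) {q p : ℕ} (hq : q.Prime)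
    (hp : p.Prime) (hq4 : q % 4 = 3) (hp4 : p % 4 = 1) (hqp : q ≠ p) (hq7 : jacobiSym q 7 = -1) (hp7 : jacobiSym p 7 = 1)
    {N : ℕ} [NeZero N] (hN : cm7.conductorNorm ℤ = N) (D₀ : ModularParametrizationData cm7 N)
    (h0 : ∃ h, D₀.cuspZeroPoint = Affine.Point.some 2 (-1) h)
    {s : ringClassField K ι 1} (hs : (s : ℂ) ^ 2 = -((q : ℂ) * p)) :
    ∃ (H₂ : HeegnerDatum N (NumberField.discr (ℚ⟮s⟯ : IntermediateField ℚ (ringClassField K ι 1))))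
      (P₂ : (cm7.baseChange (ℚ⟮s⟯ : IntermediateField ℚ (ringClassField K ι 1))).toAffine.Point),
      Affine.Point.map ((ringClassField K ι 1).subtype.comp (algebraMap ℚ⟮s⟯ (ringClassField K ι 1))).toRatAlgHom P₂ =
          heegnerPointComplex D₀ H₂ ∧
      (∀ t : ringClassField K ι 1 →ₐ[ℚ] ringClassField K ι 1, t s = s →
        Affine.Point.map t (Affine.Point.map (ℚ⟮s⟯).val P₂) = Affine.Point.map (ℚ⟮s⟯).val P₂) ∧
      (∀ t : ringClassField K ι 1 →ₐ[ℚ] ringClassField K ι 1, t s = -s →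
        Affine.Point.map (ℚ⟮s⟯).val P₂ + Affine.Point.map t (Affine.Point.map (ℚ⟮s⟯).val P₂) = 0) := by
  have hK₂ := isImaginaryQuadratic_adjoin_sqrt_neg_two_primes ι hq hp hs
  have hH₂ := satisfiesHeegnerHypothesis_adjoin_sqrt_neg_two_primes ι hq hp hq4 hp4 hqp hq7 hp7 hs hN
  have hdK₂ := discr_adjoin_sqrt_neg_two_primes ι hq hp hq4 hp4 hqp hs
  obtain ⟨β₂, hβ₂⟩ := exists_dvd_sq_sub_discr_holds N _ hK₂ hH₂
  obtain ⟨H₂, -⟩ := nonempty_heegnerDatum_holds N _ hK₂ hβ₂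
  set ι₂ : (ℚ⟮s⟯ : IntermediateField ℚ (ringClassField K ι 1)) →+* ℂ :=
    (ringClassField K ι 1).subtype.comp (algebraMap ℚ⟮s⟯ (ringClassField K ι 1)) with hι₂
  obtain ⟨P₂, hP₂⟩ := heegnerPointComplex_mem_range_map_holds N cm7 _ hK₂ hH₂ D₀ H₂ ι₂
  have heven : Even H₂.reps.card := even_card_reps_of_discr_negTwoPrimes hK₂ hq hp hq4 hp4 hqp hdK₂ hH₂ D₀ H₂ ι₂
  refine ⟨H₂, P₂, hP₂, fun t ht ↦ ?_, fun t ht ↦ ?_⟩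
  · rw [Affine.Point.map_map, algHom_comp_val_eq_of_apply_eq ι t ht]
  · -- the non-trivial automorphism `c` of `K₂`, `c s = −s`
    have hθ : (⟨s, IntermediateField.mem_adjoin_simple_self ℚ s⟩ : ℚ⟮s⟯) ∉
        Set.range (algebraMap ℚ (ℚ⟮s⟯ : IntermediateField ℚ (ringClassField K ι 1))) := by
      rintro ⟨a, ha⟩
      have h5 : a ^ 2 = -((q : ℚ) * p) := by
        apply (algebraMap ℚ (ℚ⟮s⟯ : IntermediateField ℚ (ringClassField K ι 1))).injective
        rw [map_pow, ha]
        exact adjoinGen_sq_neg_two_primes ι hs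
      have : (0 : ℚ) < q := by exact_mod_cast hq.pos
      have : (0 : ℚ) < p := by exact_mod_cast hp.pos
      nlinarith [sq_nonneg a]
    have hc2 := adjoinGen_sq_neg_two_primes ι hs
    set c := Literature.NumberTheory.QuadraticFields.Quadratic.conj (finrank_adjoin_sqrt_neg_two_primes ι hq hp hs) hθ hc2 with hc_def
    have hcr : c ⟨s, IntermediateField.mem_adjoin_simple_self ℚ s⟩ = -⟨s, IntermediateField.mem_adjoin_simple_self ℚ s⟩ :=
      Literature.NumberTheory.QuadraticFields.Quadratic.conj_gen _ hθ hc2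
    have hcne : c ≠ AlgHom.id ℚ _ := by
      intro h
      have h1 := congrArg (fun f : (ℚ⟮s⟯ : IntermediateField ℚ (ringClassField K ι 1)) →ₐ[ℚ] ℚ⟮s⟯ ↦
        f ⟨s, IntermediateField.mem_adjoin_simple_self ℚ s⟩) h
      simp only [AlgHom.id_apply] at h1
      rw [h1] at hcr
      have h2 : (⟨s, IntermediateField.mem_adjoin_simple_self ℚ s⟩ : ℚ⟮s⟯) = 0 := by
        have h2' := add_eq_zero_iff_eq_neg.mpr hcr
        rw [← two_mul] at h2'
        exact (mul_eq_zero.mp h2').resolve_left two_ne_zero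
      have h3 := adjoinGen_sq_neg_two_primes ι hs
      rw [h2, zero_pow two_ne_zero, map_neg, map_mul, map_natCast, map_natCast] at h3
      have hq0 : (q : (ℚ⟮s⟯ : IntermediateField ℚ (ringClassField K ι 1))) ≠ 0 := by exact_mod_cast hq.ne_zero
      have hp0 : (p : (ℚ⟮s⟯ : IntermediateField ℚ (ringClassField K ι 1))) ≠ 0 := by exact_mod_cast hp.ne_zero
      exact (mul_ne_zero hq0 hp0) (neg_eq_zero.mp h3.symm)
    -- Birch: `ι₂(cP₂ + P₂) = h • φ(0) = h • T = O`
    have hB := map_cm7_heegnerPoint_conj_add_eq_card_smul hK₂ hN hH₂ D₀ hw H₂ ι₂ hP₂ hcne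
    obtain ⟨h0', hh⟩ := h0
    have hzero : H₂.reps.card • D₀.cuspZeroPoint = 0 := by
      obtain ⟨k, hk⟩ := heven
      rw [hh, hk, ← two_mul, mul_nsmul, two_nsmul, cm7_twoTorsion_add_self ℂ, nsmul_zero]
    rw [hzero, ← map_zero (Affine.Point.map (W' := cm7) ι₂.toRatAlgHom)] at hB
    have hB' : Affine.Point.map (W' := cm7) c P₂ + P₂ = 0 := Affine.Point.map_injective (f := ι₂.toRatAlgHom) hB
    have hmm : Affine.Point.map (W' := cm7) (ℚ⟮s⟯).val (Affine.Point.map (W' := cm7) c P₂) =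
        Affine.Point.map (W' := cm7) ((ℚ⟮s⟯).val.comp c) P₂ := by
      cases P₂ <;> rfl
    have hB'' := congrArg (Affine.Point.map (W' := cm7) (ℚ⟮s⟯).val) hB'
    rw [map_add, hmm, map_zero] at hB''
    rw [Affine.Point.map_map, algHom_comp_val_eq_of_apply_eq_neg ι t ht c hcr, add_comm]
    exact hB''

end Partner

end Summit.BirchSwinnertonDyer.BirchSwinnertonDyer.Theorems.GoldfeldGoodTwists

end
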